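import Mathlib.Analysis.SpecialFunctions.Pow.Real
import Mathlib.Analysis.SpecialFunctions.Sqrt
import Mathlib.LinearAlgebra.FiniteDimensional.Lemmas
import Literature.Computability.AlgebraicComplexity.SetMultilinear
import Literature.Computability.AlgebraicComplexity.OuterProductRank
import HarnessLib

/-!
# The relative-rank measure of Limaye–Srinivasan–Tavenas (Claim 7)

(N. Limaye, S. Srinivasan, S. Tavenas, *Superpolynomial lower bounds against low-depth algebraic
circuits*, J. ACM 72 (2025), Art. 26 = FOCS 2021, §2.1 "The complexity measure".)

Blocks of variables `X i`, `i : ι`, are glued into the variable type `Σ i, X i` with block map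
`Sigma.fst`; a sign map `pos : ι → Bool` splits the blocks into *positive* and *negative* ones
(LST: `P_w = {i | w_i > 0}`, `N_w = {i | w_i < 0}`). For a finite set `S` of blocks and a
polynomial `f`, the matrix `M_w(f)` of LST, §2.1 has rows indexed by the set-multilinear monomials
over the positive blocks of `S` (= assignments `r : Π i ∈ S⁺, X i`), columns by those over the
negative blocks, and entry `(r, c)` the coefficient in `f` of the monomial `r · c`. Its rank,
normalised by `√(#rows · #cols) = √(∏_{i ∈ S} |X i|)`, is the **relative rank**
`relRank pos S f ∈ [0, 1]`.

## Content (all proved)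

* `assignMonomial`, `coeffMat`, `pdRank` (rank of `M_w(f)` as the dimension of the span of its
  rows), `relRankPair` (explicit row/column block sets), `relRank pos S f`.
* **Claim 7** of LST: (1) *imbalance* `relRank ≤ √(#rows/#cols)` and `≤ √(#cols/#rows)`
  (`relRankPair_le_sqrt_div`, `relRankPair_le_sqrt_div'`); (2) *sub-additivity*
  `relRank (f + g) ≤ relRank f + relRank g`, with scalars free, hence the bound for linear
  combinations / span membership (`relRank_sum_smul_le`, `relRank_le_sum_of_mem_span`);
  (3) *multiplicativity* for a product of set-multilinear polynomials over disjoint block sets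
  (`pdRank_mul`, `relRankPair_mul`, `relRank_mul`, `relRank_finset_prod`), via "the matrix of a
  product is the Kronecker product" — here: the rows of `M(fg)` are the outer products of the rows
  of `M(f)` and `M(g)` (`finrank_span_outerFun` of `OuterProductRank.lean`).
* `relRank` only sees the set-multilinear part over `S` (`relRank_smlProj`), and `0 ≤ relRank ≤ 1`.

## Design

* Rank = `finrank` of the span of the rows (functions on the column index type), over a field
  `K`; no `Matrix.rank`, so that both full-rank arguments needed later (independent rows, or rows
  containing all standard basis vectors) stay elementary.
* The core objects take the row block set `A` and the column block set `B` explicitly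
  (`coeffMat K A B`, `pdRank`, `relRankPair`); `relRank pos S` is the wrapper with
  `A = S.filter pos`, `B = S.filter (!pos ·)`. This keeps the dependent types of assignments out
  of the multiplicativity statement (unions of row sets are `Equiv.piFinsetUnion`).
* Deliberately NOT here: words, `2^{|w_i|}`-sized blocks and the bound `2^{-|w_S|/2}` (they are
  the specialisation `|X i| = 2^{|w i|}` of the imbalance inequality, done with the word
  combinatorics), and any circuit.

## References

* N. Limaye, S. Srinivasan, S. Tavenas, J. ACM 72 (2025), Art. 26, §2.1, Claim 7 (and its proof,
  pp. 26:8–26:9).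
-/

noncomputable section

open MvPolynomial Finsupp Module Submodule

namespace Literature.Computability.AlgebraicComplexity

open OuterProductRank

universe u v w

variable {ι : Type v} {X : ι → Type w}

/-! ### Assignments and their monomials -/

/-- An *assignment* on a finite set `A` of blocks: a choice of one variable in each block
`i ∈ A`; these index the set-multilinear monomials over `A` (LST 2025, §2.1, the index sets
`M_w^P`, `M_w^N`). [cite: LimayeSrinivasanTavenas2025, §2.1] -/
abbrev Assignment (X : ι → Type w) (A : Finset ι) : Type (max v w) :=
  ∀ i : A, X i

/-- The set-multilinear monomial `∏_{i ∈ A} x_{i, r i}` of an assignment `r` (LST 2025, §2.1).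
[cite: LimayeSrinivasanTavenas2025, §2.1] -/
def assignMonomial (A : Finset ι) (r : Assignment X A) : (Σ i, X i) →₀ ℕ :=
  ∑ i ∈ A.attach, Finsupp.single ⟨i, r i⟩ 1

/-- The block-degree vector of an assignment monomial on `A` is the profile of `A`: assignment
monomials are set-multilinear over `A`. [cite: LimayeSrinivasanTavenas2025, §2.1] -/
theorem weight_assignMonomial (A : Finset ι) (r : Assignment X A) :
    weight (blockWeight (Sigma.fst : (Σ i, X i) → ι)) (assignMonomial A r) = blockProfile A := by
  unfold assignMonomial blockProfile
  rw [map_sum]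
  simp_rw [weight_blockWeight_single]
  exact Finset.sum_attach A fun i => Finsupp.single i 1

/-- Values of an assignment monomial: `1` at the chosen variable of each block of `A`, `0`
elsewhere. [folklore] -/
theorem assignMonomial_apply [DecidableEq ι] [∀ i, DecidableEq (X i)] (A : Finset ι)
    (r : Assignment X A) (i : ι) (x : X i) :
    assignMonomial A r ⟨i, x⟩ = if h : i ∈ A then (if r ⟨i, h⟩ = x then 1 else 0) else 0 := by
  unfold assignMonomial
  rw [Finsupp.finsetSum_apply]
  by_cases h : i ∈ A
  · rw [dif_pos h, Finset.sum_eq_single_of_mem (⟨i, h⟩ : A) (Finset.mem_attach _ _)]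
    · simp only [Finsupp.single_apply, Sigma.mk.inj_iff, heq_eq_eq, true_and]
    · rintro ⟨j, hj⟩ _ hne
      rw [Finsupp.single_apply, if_neg]
      intro heq
      apply hne
      exact Subtype.ext (Sigma.mk.inj_iff.1 heq).1
  · rw [dif_neg h]
    refine Finset.sum_eq_zero ?_
    rintro ⟨j, hj⟩ _
    rw [Finsupp.single_apply, if_neg]
    intro heq
    exact h ((Sigma.mk.inj_iff.1 heq).1 ▸ hj)

/-- An assignment monomial vanishes at every variable outside the blocks of `A`. [folklore] -/
theorem assignMonomial_apply_of_notMem (A : Finset ι) (r : Assignment X A) (v : Σ i, X i)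
    (hv : v.1 ∉ A) : assignMonomial A r v = 0 := by
  classical
  obtain ⟨i, x⟩ := v
  rw [assignMonomial_apply, dif_neg hv]

/-- An assignment monomial takes the value `1` at each chosen variable. [folklore] -/
theorem assignMonomial_apply_self (A : Finset ι) (r : Assignment X A) (i : A) :
    assignMonomial A r ⟨i, r i⟩ = 1 := by
  classical
  rw [assignMonomial_apply, dif_pos i.2]
  simp

/-- **Splitting of assignment monomials over a disjoint union**: the monomial of the glued
assignment `(r₁, r₂)` on `A₁ ∪ A₂` is the product (sum of exponent vectors) of the monomials of
`r₁` and `r₂` (LST 2025, proof of Claim 7(3)). [cite: LimayeSrinivasanTavenas2025, Claim 7] -/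
theorem assignMonomial_piFinsetUnion [DecidableEq ι] {A₁ A₂ : Finset ι} (h : Disjoint A₁ A₂)
    (r₁ : Assignment X A₁) (r₂ : Assignment X A₂) :
    assignMonomial (A₁ ∪ A₂) (Equiv.piFinsetUnion X h (r₁, r₂)) =
      assignMonomial A₁ r₁ + assignMonomial A₂ r₂ := by
  classical
  ext ⟨i, x⟩
  simp only [Finsupp.add_apply, assignMonomial_apply]
  by_cases h1 : i ∈ A₁
  · have h2 : i ∉ A₂ := Finset.disjoint_left.1 h h1
    rw [dif_pos (Finset.mem_union_left _ h1), dif_pos h1, dif_neg h2, add_zero,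
      Equiv.piFinsetUnion_left X h h1]
  · by_cases h2 : i ∈ A₂
    · rw [dif_pos (Finset.mem_union_right _ h2), dif_neg h1, dif_pos h2, zero_add,
        Equiv.piFinsetUnion_right X h h2]
    · rw [dif_neg (by simp [h1, h2]), dif_neg h1, dif_neg h2]

/-- Assignments are determined by their monomials (even jointly for two disjoint block sets).
[folklore] -/
theorem assignMonomial_add_injective [DecidableEq ι] {A B : Finset ι} (h : Disjoint A B)
    {r r' : Assignment X A} {c c' : Assignment X B}
    (heq : assignMonomial A r + assignMonomial B c = assignMonomial A r' + assignMonomial B c') :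
    r = r' ∧ c = c' := by
  classical
  constructor
  · funext i
    have := DFunLike.congr_fun heq ⟨i, r i⟩
    rw [Finsupp.add_apply, Finsupp.add_apply, assignMonomial_apply_self,
      assignMonomial_apply_of_notMem B c _ (Finset.disjoint_left.1 h i.2),
      assignMonomial_apply_of_notMem B c' _ (Finset.disjoint_left.1 h i.2),
      assignMonomial_apply, dif_pos i.2] at this
    by_contra hne
    rw [if_neg (fun h' => hne h'.symm)] at this
    simp at this
  · funext i
    have := DFunLike.congr_fun heq ⟨i, c i⟩
    rw [Finsupp.add_apply, Finsupp.add_apply, assignMonomial_apply_self,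
      assignMonomial_apply_of_notMem A r _ (Finset.disjoint_right.1 h i.2),
      assignMonomial_apply_of_notMem A r' _ (Finset.disjoint_right.1 h i.2),
      assignMonomial_apply B c', dif_pos i.2] at this
    by_contra hne
    rw [if_neg (fun h' => hne h'.symm)] at this
    simp at this

/-! ### Block supports and the unique-splitting lemma -/

section BlockSupport

variable {σ : Type*}

/-- `m` is *supported on the blocks `T`*: it involves no variable outside these blocks.
[folklore] -/
def BlockSupportedOn (blk : σ → ι) (T : Finset ι) (m : σ →₀ ℕ) : Prop :=
  ∀ v, blk v ∉ T → m v = 0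

/-- The degree of a monomial in a variable is at most its degree in the variable's block.
[folklore] -/
theorem apply_le_weight_blockWeight (blk : σ → ι) (m : σ →₀ ℕ) (v : σ) :
    m v ≤ weight (blockWeight blk) m (blk v) := by
  classical
  rw [weight_blockWeight_eq_mapDomain, Finsupp.mapDomain, Finsupp.sum_apply]
  by_cases hv : v ∈ m.support
  · rw [Finsupp.sum]
    refine le_trans (le_of_eq ?_)
      (Finset.single_le_sum (f := fun a => (Finsupp.single (blk a) (m a)) (blk v))
        (fun a _ => Nat.zero_le _) hv)
    simp
  · rw [Finsupp.notMem_support_iff.1 hv]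
    exact Nat.zero_le _

/-- A monomial whose block-degree vector is the profile of `T` is supported on the blocks `T`.
[folklore] -/
theorem blockSupportedOn_of_weight_eq [DecidableEq ι] {blk : σ → ι} {T : Finset ι} {m : σ →₀ ℕ}
    (h : weight (blockWeight blk) m = blockProfile T) : BlockSupportedOn blk T m := by
  intro v hv
  have := apply_le_weight_blockWeight blk m v
  rw [h, blockProfile_apply, if_neg hv] at this
  exact Nat.le_zero.1 this

/-- Sums of monomials supported on `T` are supported on `T`. [folklore] -/
theorem BlockSupportedOn.add {blk : σ → ι} {T : Finset ι} {a b : σ →₀ ℕ}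
    (ha : BlockSupportedOn blk T a) (hb : BlockSupportedOn blk T b) :
    BlockSupportedOn blk T (a + b) := fun v hv => by
  rw [Finsupp.add_apply, ha v hv, hb v hv]

/-- Enlarging the block set preserves block support. [folklore] -/
theorem BlockSupportedOn.mono {blk : σ → ι} {T T' : Finset ι} (h : T ⊆ T') {a : σ →₀ ℕ}
    (ha : BlockSupportedOn blk T a) : BlockSupportedOn blk T' a := fun v hv =>
  ha v fun h' => hv (h h')

/-- **Unique splitting along disjoint blocks**: if `a, m₁` are supported on the blocks `T₁` and
`b, m₂` on the disjoint blocks `T₂`, then `a + b = m₁ + m₂` forces `a = m₁` and `b = m₂` (the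
reason why `M_w(f₁ f₂) = M_w(f₁) ⊗ M_w(f₂)` in LST 2025, proof of Claim 7(3)).
[cite: LimayeSrinivasanTavenas2025, Claim 7] -/
theorem BlockSupportedOn.eq_of_add_eq_add {blk : σ → ι} {T₁ T₂ : Finset ι} (hT : Disjoint T₁ T₂)
    {a b m₁ m₂ : σ →₀ ℕ} (ha : BlockSupportedOn blk T₁ a) (hb : BlockSupportedOn blk T₂ b)
    (h₁ : BlockSupportedOn blk T₁ m₁) (h₂ : BlockSupportedOn blk T₂ m₂) (h : a + b = m₁ + m₂) :
    a = m₁ ∧ b = m₂ := by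
  have hpt : ∀ v, a v + b v = m₁ v + m₂ v := fun v => by
    have := DFunLike.congr_fun h v
    simpa using this
  constructor
  · ext v
    by_cases hv : blk v ∈ T₁
    · have hv2 : blk v ∉ T₂ := Finset.disjoint_left.1 hT hv
      have := hpt v
      rw [hb v hv2, h₂ v hv2] at this
      simpa using this
    · rw [ha v hv, h₁ v hv]
  · ext v
    by_cases hv : blk v ∈ T₂
    · have hv1 : blk v ∉ T₁ := Finset.disjoint_right.1 hT hv
      have := hpt v
      rw [ha v hv1, h₁ v hv1] at this
      simpa using this
    · rw [hb v hv, h₂ v hv]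

end BlockSupport

/-! ### The coefficient matrix and its rank -/

section Rank

variable (K : Type u) [Field K]

/-- The coefficient matrix `M_w(f)` of LST 2025, §2.1, with explicit row block set `A` and column
block set `B`: entry `(r, c)` is the coefficient in `f` of the product of the assignment
monomials of `r` and `c`. [cite: LimayeSrinivasanTavenas2025, §2.1] -/
def coeffMat (A B : Finset ι) (f : MvPolynomial (Σ i, X i) K) :
    Assignment X A → Assignment X B → K :=
  fun r c => coeff (assignMonomial A r + assignMonomial B c) f

variable [∀ i, Fintype (X i)]

/-- `rank M_w(f)`: the dimension of the span of the rows of the coefficient matrix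
(LST 2025, §2.1). [cite: LimayeSrinivasanTavenas2025, §2.1] -/
def pdRank (A B : Finset ι) (f : MvPolynomial (Σ i, X i) K) : ℕ :=
  finrank K (span K (Set.range (coeffMat K A B f)))

/-- The relative rank with explicit row/column block sets:
`rank M(f) / √(#rows · #cols)`, `#rows = ∏_{i ∈ A} |X i|`, `#cols = ∏_{i ∈ B} |X i|`
(LST 2025, §2.1, `relrk_w`). [cite: LimayeSrinivasanTavenas2025, §2.1] -/
def relRankPair (A B : Finset ι) (f : MvPolynomial (Σ i, X i) K) : ℝ :=
  pdRank K A B f /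
    Real.sqrt ((∏ i ∈ A, (Fintype.card (X i) : ℝ)) * ∏ i ∈ B, (Fintype.card (X i) : ℝ))

/-- **The relative rank `relrk_w(f)` restricted to the blocks `S`** (LST 2025, §2.1): rows are the
set-multilinear monomials over the positive blocks `S⁺ = {i ∈ S | pos i}`, columns those over the
negative blocks `S⁻`, and `relRank pos S f = rank M_{w|S}(f) / √(|M^P| · |M^N|) ∈ [0, 1]`. Only
the set-multilinear part of `f` over `S` matters (`relRank_smlProj`).
[cite: LimayeSrinivasanTavenas2025, §2.1] -/
def relRank (pos : ι → Bool) (S : Finset ι) (f : MvPolynomial (Σ i, X i) K) : ℝ :=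
  relRankPair K (S.filter fun i => pos i) (S.filter fun i => !pos i) f

variable {K}

/-! #### Rank bounds: rows, columns (imbalance) -/

omit [∀ i, Fintype (X i)] in
/-- Entries of the coefficient matrix (unfolding lemma).
[cite: LimayeSrinivasanTavenas2025, §2.1] -/
@[simp]
theorem coeffMat_apply (A B : Finset ι) (f : MvPolynomial (Σ i, X i) K) (r : Assignment X A)
    (c : Assignment X B) :
    coeffMat K A B f r c = coeff (assignMonomial A r + assignMonomial B c) f := rfl

/-- The number of assignments on `A` is `∏_{i ∈ A} |X i|` (LST 2025, §2.1:
`|M_w^P| = 2^{∑_{i ∈ P_w} w_i}`). [cite: LimayeSrinivasanTavenas2025, §2.1] -/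
theorem card_assignment [DecidableEq ι] (A : Finset ι) :
    Fintype.card (Assignment X A) = ∏ i ∈ A, Fintype.card (X i) := by
  rw [Fintype.card_pi, Finset.prod_coe_sort A fun i => Fintype.card (X i)]

/-- `rank M(f) ≤ #rows`. [cite: LimayeSrinivasanTavenas2025, Claim 7] -/
theorem pdRank_le_card_rows [DecidableEq ι] (A B : Finset ι) (f : MvPolynomial (Σ i, X i) K) :
    pdRank K A B f ≤ ∏ i ∈ A, Fintype.card (X i) := by
  classical
  rw [← card_assignment]
  exact finrank_range_le_card _

/-- `rank M(f) ≤ #columns`. [cite: LimayeSrinivasanTavenas2025, Claim 7] -/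
theorem pdRank_le_card_cols [DecidableEq ι] (A B : Finset ι) (f : MvPolynomial (Σ i, X i) K) :
    pdRank K A B f ≤ ∏ i ∈ B, Fintype.card (X i) := by
  classical
  rw [← card_assignment, ← Module.finrank_fintype_fun_eq_card (R := K) (η := Assignment X B)]
  exact Submodule.finrank_le _

/-! #### Sub-additivity and scalars -/

/-- `rank M(f + g) ≤ rank M(f) + rank M(g)`: `M(f + g) = M(f) + M(g)` and rank is sub-additive
(LST 2025, Claim 7(2)). [cite: LimayeSrinivasanTavenas2025, Claim 7] -/
theorem pdRank_add_le (A B : Finset ι) (f g : MvPolynomial (Σ i, X i) K) :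
    pdRank K A B (f + g) ≤ pdRank K A B f + pdRank K A B g := by
  classical
  unfold pdRank
  have hle : span K (Set.range (coeffMat K A B (f + g))) ≤
      span K (Set.range (coeffMat K A B f)) ⊔ span K (Set.range (coeffMat K A B g)) := by
    rw [Submodule.span_le]
    rintro _ ⟨r, rfl⟩
    have : coeffMat K A B (f + g) r = coeffMat K A B f r + coeffMat K A B g r := by
      funext c; simp [coeffMat]
    rw [this]
    exact Submodule.add_mem_sup (subset_span ⟨r, rfl⟩) (subset_span ⟨r, rfl⟩)
  exact (Submodule.finrank_mono hle).trans (Submodule.finrank_add_le_finrank_add_finrank _ _)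

/-- Scalars do not increase the rank: `rank M(c • f) ≤ rank M(f)`.
[cite: LimayeSrinivasanTavenas2025, Claim 7] -/
theorem pdRank_smul_le (A B : Finset ι) (a : K) (f : MvPolynomial (Σ i, X i) K) :
    pdRank K A B (a • f) ≤ pdRank K A B f := by
  unfold pdRank
  refine Submodule.finrank_mono ?_
  rw [Submodule.span_le]
  rintro _ ⟨r, rfl⟩
  have : coeffMat K A B (a • f) r = a • coeffMat K A B f r := by
    funext c; simp [coeffMat]
  rw [this]
  exact Submodule.smul_mem _ _ (subset_span ⟨r, rfl⟩)

omit [∀ i, Fintype (X i)] in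
/-- `rank M(0) = 0`. [folklore] -/
@[simp]
theorem pdRank_zero (A B : Finset ι) : pdRank K A B (0 : MvPolynomial (Σ i, X i) K) = 0 := by
  unfold pdRank
  have : Set.range (coeffMat K A B (0 : MvPolynomial (Σ i, X i) K)) ⊆ {0} := by
    rintro _ ⟨r, rfl⟩
    simp only [Set.mem_singleton_iff]
    funext c; simp [coeffMat]
  have h0 : span K (Set.range (coeffMat K A B (0 : MvPolynomial (Σ i, X i) K))) = ⊥ := by
    rw [Submodule.span_eq_bot]
    intro x hx
    exact this hx
  rw [h0, finrank_bot]

/-- Rank of a linear combination: `rank M(∑ aⱼ • fⱼ) ≤ ∑ rank M(fⱼ)`.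
[cite: LimayeSrinivasanTavenas2025, Claim 7] -/
theorem pdRank_sum_smul_le {κ : Type*} (s : Finset κ) (A B : Finset ι) (a : κ → K)
    (f : κ → MvPolynomial (Σ i, X i) K) :
    pdRank K A B (∑ j ∈ s, a j • f j) ≤ ∑ j ∈ s, pdRank K A B (f j) := by
  classical
  induction s using Finset.induction_on with
  | empty => simp
  | insert j s hj ih =>
    rw [Finset.sum_insert hj, Finset.sum_insert hj]
    exact (pdRank_add_le _ _ _ _).trans (add_le_add (pdRank_smul_le _ _ _ _) ih)

/-! #### Only the set-multilinear part over `A ∪ B` matters -/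

omit [∀ i, Fintype (X i)] in
/-- The coefficient matrix of `f` on row blocks `A` and column blocks `B` (disjoint) only sees
the set-multilinear part of `f` over `A ∪ B`. [cite: LimayeSrinivasanTavenas2025, §2.1] -/
theorem coeffMat_smlProj [DecidableEq ι] {A B : Finset ι} (h : Disjoint A B)
    (f : MvPolynomial (Σ i, X i) K) :
    coeffMat K A B (smlProj Sigma.fst (A ∪ B) f) = coeffMat K A B f := by
  funext r c
  simp only [coeffMat, coeff_smlProj, map_add, weight_assignMonomial, blockProfile_union h,
    if_true]

omit [∀ i, Fintype (X i)] in
/-- `rank M_{A,B}(smlProj (A ∪ B) f) = rank M_{A,B}(f)`.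
[cite: LimayeSrinivasanTavenas2025, §2.1] -/
theorem pdRank_smlProj [DecidableEq ι] {A B : Finset ι} (h : Disjoint A B)
    (f : MvPolynomial (Σ i, X i) K) :
    pdRank K A B (smlProj Sigma.fst (A ∪ B) f) = pdRank K A B f := by
  unfold pdRank; rw [coeffMat_smlProj h]

omit [∀ i, Fintype (X i)] in
/-- A polynomial that is set-multilinear over a block set other than `A ∪ B` has
`rank M_{A,B} = 0`. [cite: LimayeSrinivasanTavenas2025, §2.1] -/
theorem pdRank_eq_zero_of_isSetMultilinear [DecidableEq ι] {A B T : Finset ι} (h : Disjoint A B)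
    {f : MvPolynomial (Σ i, X i) K} (hf : IsSetMultilinear Sigma.fst T f) (hT : A ∪ B ≠ T) :
    pdRank K A B f = 0 := by
  rw [← pdRank_smlProj h, hf.smlProj_of_ne _ hT, pdRank_zero]

/-! #### Multiplicativity (Kronecker) -/

omit [∀ i, Fintype (X i)] in
/-- **Entries of `M(f g)` factor**: for `f` set-multilinear over `A₁ ∪ B₁` and `g` over the
disjoint `A₂ ∪ B₂`, the entry of `M(fg)` at the glued row `(r₁, r₂)` and glued column `(c₁, c₂)`
is `M(f)_{r₁ c₁} · M(g)_{r₂ c₂}` — i.e. `M_w(f g) = M_w(f) ⊗ M_w(g)` (LST 2025, proof of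
Claim 7(3), p. 26:9). [cite: LimayeSrinivasanTavenas2025, Claim 7] -/
theorem coeffMat_mul [DecidableEq ι] {A₁ A₂ B₁ B₂ : Finset ι} (hA : Disjoint A₁ A₂)
    (hB : Disjoint B₁ B₂) (hS : Disjoint (A₁ ∪ B₁) (A₂ ∪ B₂))
    {f g : MvPolynomial (Σ i, X i) K} (hf : IsSetMultilinear Sigma.fst (A₁ ∪ B₁) f)
    (hg : IsSetMultilinear Sigma.fst (A₂ ∪ B₂) g) (r₁ : Assignment X A₁) (r₂ : Assignment X A₂)
    (c₁ : Assignment X B₁) (c₂ : Assignment X B₂) :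
    coeffMat K (A₁ ∪ A₂) (B₁ ∪ B₂) (f * g) (Equiv.piFinsetUnion X hA (r₁, r₂))
        (Equiv.piFinsetUnion X hB (c₁, c₂)) =
      coeffMat K A₁ B₁ f r₁ c₁ * coeffMat K A₂ B₂ g r₂ c₂ := by
  classical
  simp only [coeffMat, assignMonomial_piFinsetUnion]
  set m₁ := assignMonomial A₁ r₁ + assignMonomial B₁ c₁ with hm₁
  set m₂ := assignMonomial A₂ r₂ + assignMonomial B₂ c₂ with hm₂
  have hrearr : assignMonomial A₁ r₁ + assignMonomial A₂ r₂ +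
      (assignMonomial B₁ c₁ + assignMonomial B₂ c₂) = m₁ + m₂ := by
    rw [hm₁, hm₂]; abel
  rw [hrearr, coeff_mul]
  -- block supports
  have hs₁ : BlockSupportedOn Sigma.fst (A₁ ∪ B₁) m₁ :=
    (blockSupportedOn_of_weight_eq (weight_assignMonomial A₁ r₁)).mono
        Finset.subset_union_left |>.add
      ((blockSupportedOn_of_weight_eq (weight_assignMonomial B₁ c₁)).mono
        Finset.subset_union_right)
  have hs₂ : BlockSupportedOn Sigma.fst (A₂ ∪ B₂) m₂ :=
    (blockSupportedOn_of_weight_eq (weight_assignMonomial A₂ r₂)).mono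
        Finset.subset_union_left |>.add
      ((blockSupportedOn_of_weight_eq (weight_assignMonomial B₂ c₂)).mono
        Finset.subset_union_right)
  rw [Finset.sum_eq_single (m₁, m₂)]
  · rintro ⟨a, b⟩ hab hne
    by_contra hprod
    have ha : coeff a f ≠ 0 := fun h0 => hprod (by rw [h0, zero_mul])
    have hb : coeff b g ≠ 0 := fun h0 => hprod (by rw [h0, mul_zero])
    have ha' := blockSupportedOn_of_weight_eq (hf ha)
    have hb' := blockSupportedOn_of_weight_eq (hg hb)
    obtain ⟨h1, h2⟩ := BlockSupportedOn.eq_of_add_eq_add hS ha' hb' hs₁ hs₂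
      (Finset.mem_antidiagonal.1 hab)
    exact hne (Prod.ext h1 h2)
  · intro h
    exact (h (Finset.mem_antidiagonal.2 rfl)).elim

/-- **Multiplicativity of the rank** (LST 2025, Claim 7(3): `rank(M(f₁ ⋯ f_t)) = ∏ rank M(fᵢ)`,
binary case): for `f` set-multilinear over `A₁ ∪ B₁` and `g` over the disjoint `A₂ ∪ B₂`,
`rank M_{A₁∪A₂, B₁∪B₂}(f g) = rank M_{A₁,B₁}(f) · rank M_{A₂,B₂}(g)` — the rows of `M(fg)` are the
outer products of the rows of `M(f)` and of `M(g)`. [cite: LimayeSrinivasanTavenas2025, Claim 7] -/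
theorem pdRank_mul [DecidableEq ι] {A₁ A₂ B₁ B₂ : Finset ι} (hA : Disjoint A₁ A₂)
    (hB : Disjoint B₁ B₂) (hS : Disjoint (A₁ ∪ B₁) (A₂ ∪ B₂))
    {f g : MvPolynomial (Σ i, X i) K} (hf : IsSetMultilinear Sigma.fst (A₁ ∪ B₁) f)
    (hg : IsSetMultilinear Sigma.fst (A₂ ∪ B₂) g) :
    pdRank K (A₁ ∪ A₂) (B₁ ∪ B₂) (f * g) = pdRank K A₁ B₁ f * pdRank K A₂ B₂ g := by
  classical
  unfold pdRank
  set eA := Equiv.piFinsetUnion X hA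
  set eB := Equiv.piFinsetUnion X hB
  set L : (Assignment X (B₁ ∪ B₂) → K) ≃ₗ[K] (Assignment X B₁ × Assignment X B₂ → K) :=
    LinearEquiv.funCongrLeft K K eB
  have key : (L ∘ (coeffMat K (A₁ ∪ A₂) (B₁ ∪ B₂) (f * g) ∘ eA)) =
      fun rr : Assignment X A₁ × Assignment X A₂ =>
        outerFun (coeffMat K A₁ B₁ f rr.1) (coeffMat K A₂ B₂ g rr.2) := by
    funext rr cc
    obtain ⟨r₁, r₂⟩ := rr
    obtain ⟨c₁, c₂⟩ := cc
    simp only [Function.comp_apply, L, LinearEquiv.funCongrLeft_apply, LinearMap.funLeft_apply,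
      outerFun_apply]
    exact coeffMat_mul hA hB hS hf hg r₁ r₂ c₁ c₂
  rw [← span_range_comp_of_surjective _ eA.surjective,
    ← finrank_span_range_comp_linearEquiv L, key, finrank_span_outerFun]

/-! ### The relative rank -/

/-- The size of a block set: `∏_{i ∈ A} |X i|`, as a real number, is positive when no block is
empty. [folklore] -/
theorem prod_card_pos [∀ i, Nonempty (X i)] (A : Finset ι) :
    0 < ∏ i ∈ A, (Fintype.card (X i) : ℝ) :=
  Finset.prod_pos fun _ _ => Nat.cast_pos.2 Fintype.card_pos

/-- `relrk ≥ 0`. [cite: LimayeSrinivasanTavenas2025, §2.1] -/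
theorem relRankPair_nonneg (A B : Finset ι) (f : MvPolynomial (Σ i, X i) K) :
    0 ≤ relRankPair K A B f :=
  div_nonneg (Nat.cast_nonneg _) (Real.sqrt_nonneg _)

/-- **Imbalance, row form**: `relrk ≤ √(#rows / #cols)` (LST 2025, Claim 7(1): rank is at most
the smaller dimension). [cite: LimayeSrinivasanTavenas2025, Claim 7] -/
theorem relRankPair_le_sqrt_div [DecidableEq ι] [∀ i, Nonempty (X i)] (A B : Finset ι)
    (f : MvPolynomial (Σ i, X i) K) :
    relRankPair K A B f ≤
      Real.sqrt ((∏ i ∈ A, (Fintype.card (X i) : ℝ)) / ∏ i ∈ B, (Fintype.card (X i) : ℝ)) := by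
  have hrank : (pdRank K A B f : ℝ) ≤ ∏ i ∈ A, (Fintype.card (X i) : ℝ) := by
    exact_mod_cast pdRank_le_card_rows (K := K) A B f
  unfold relRankPair
  set R := ∏ i ∈ A, (Fintype.card (X i) : ℝ)
  set C := ∏ i ∈ B, (Fintype.card (X i) : ℝ)
  have hR : 0 < R := prod_card_pos A
  have hC : 0 < C := prod_card_pos B
  have hsqrt : 0 < Real.sqrt (R * C) := Real.sqrt_pos.2 (mul_pos hR hC)
  rw [div_le_iff₀ hsqrt]
  calc (pdRank K A B f : ℝ) ≤ R := hrank
    _ = Real.sqrt (R / C) * Real.sqrt (R * C) := by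
        rw [← Real.sqrt_mul (div_nonneg hR.le hC.le), mul_comm R C, ← mul_assoc,
          div_mul_cancel₀ _ hC.ne', Real.sqrt_mul_self hR.le]

/-- **Imbalance, column form**: `relrk ≤ √(#cols / #rows)`.
[cite: LimayeSrinivasanTavenas2025, Claim 7] -/
theorem relRankPair_le_sqrt_div' [DecidableEq ι] [∀ i, Nonempty (X i)] (A B : Finset ι)
    (f : MvPolynomial (Σ i, X i) K) :
    relRankPair K A B f ≤
      Real.sqrt ((∏ i ∈ B, (Fintype.card (X i) : ℝ)) / ∏ i ∈ A, (Fintype.card (X i) : ℝ)) := by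
  have hrank : (pdRank K A B f : ℝ) ≤ ∏ i ∈ B, (Fintype.card (X i) : ℝ) := by
    exact_mod_cast pdRank_le_card_cols (K := K) A B f
  unfold relRankPair
  set R := ∏ i ∈ A, (Fintype.card (X i) : ℝ)
  set C := ∏ i ∈ B, (Fintype.card (X i) : ℝ)
  have hR : 0 < R := prod_card_pos A
  have hC : 0 < C := prod_card_pos B
  have hsqrt : 0 < Real.sqrt (R * C) := Real.sqrt_pos.2 (mul_pos hR hC)
  rw [div_le_iff₀ hsqrt]
  calc (pdRank K A B f : ℝ) ≤ C := hrank
    _ = Real.sqrt (C / R) * Real.sqrt (R * C) := by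
        rw [← Real.sqrt_mul (div_nonneg hC.le hR.le), ← mul_assoc,
          div_mul_cancel₀ _ hR.ne', Real.sqrt_mul_self hC.le]

/-- `relrk ≤ 1`. [cite: LimayeSrinivasanTavenas2025, §2.1] -/
theorem relRankPair_le_one [DecidableEq ι] [∀ i, Nonempty (X i)] (A B : Finset ι)
    (f : MvPolynomial (Σ i, X i) K) : relRankPair K A B f ≤ 1 := by
  set R := ∏ i ∈ A, (Fintype.card (X i) : ℝ)
  set C := ∏ i ∈ B, (Fintype.card (X i) : ℝ)
  have hR : 0 < R := prod_card_pos A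
  have hC : 0 < C := prod_card_pos B
  by_cases h : R ≤ C
  · refine (relRankPair_le_sqrt_div A B f).trans ?_
    rw [Real.sqrt_le_one]
    exact (div_le_one hC).2 h
  · refine (relRankPair_le_sqrt_div' A B f).trans ?_
    rw [Real.sqrt_le_one]
    exact (div_le_one hR).2 (le_of_not_ge h)

/-- Sub-additivity of `relrk` (LST 2025, Claim 7(2)).
[cite: LimayeSrinivasanTavenas2025, Claim 7] -/
theorem relRankPair_add_le (A B : Finset ι) (f g : MvPolynomial (Σ i, X i) K) :
    relRankPair K A B (f + g) ≤ relRankPair K A B f + relRankPair K A B g := by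
  unfold relRankPair
  rw [← add_div]
  refine div_le_div_of_nonneg_right ?_ (Real.sqrt_nonneg _)
  exact_mod_cast pdRank_add_le A B f g

/-- Scalars do not increase `relrk`. [cite: LimayeSrinivasanTavenas2025, Claim 7] -/
theorem relRankPair_smul_le (A B : Finset ι) (a : K) (f : MvPolynomial (Σ i, X i) K) :
    relRankPair K A B (a • f) ≤ relRankPair K A B f := by
  unfold relRankPair
  refine div_le_div_of_nonneg_right ?_ (Real.sqrt_nonneg _)
  exact_mod_cast pdRank_smul_le A B a f

/-- `relrk 0 = 0`. [folklore] -/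
@[simp]
theorem relRankPair_zero (A B : Finset ι) :
    relRankPair K A B (0 : MvPolynomial (Σ i, X i) K) = 0 := by
  simp [relRankPair]

/-- `relrk` of a linear combination is at most the sum of the `relrk`s (LST 2025, Claim 7(2)
iterated; scalars are free). [cite: LimayeSrinivasanTavenas2025, Claim 7] -/
theorem relRankPair_sum_smul_le {κ : Type*} (s : Finset κ) (A B : Finset ι) (a : κ → K)
    (f : κ → MvPolynomial (Σ i, X i) K) :
    relRankPair K A B (∑ j ∈ s, a j • f j) ≤ ∑ j ∈ s, relRankPair K A B (f j) := by
  classical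
  induction s using Finset.induction_on with
  | empty => simp
  | insert j s hj ih =>
    rw [Finset.sum_insert hj, Finset.sum_insert hj]
    exact (relRankPair_add_le _ _ _ _).trans (add_le_add (relRankPair_smul_le _ _ _ _) ih)

/-- `relrk` only sees the set-multilinear part over `A ∪ B`.
[cite: LimayeSrinivasanTavenas2025, §2.1] -/
theorem relRankPair_smlProj [DecidableEq ι] {A B : Finset ι} (h : Disjoint A B)
    (f : MvPolynomial (Σ i, X i) K) :
    relRankPair K A B (smlProj Sigma.fst (A ∪ B) f) = relRankPair K A B f := by
  unfold relRankPair; rw [pdRank_smlProj h]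

/-- **Multiplicativity of `relrk`** (LST 2025, Claim 7(3), binary case):
`relrk_{w|S₁ ∪ S₂}(f g) = relrk_{w|S₁}(f) · relrk_{w|S₂}(g)` for `f, g` set-multilinear over the
disjoint `S₁ = A₁ ∪ B₁`, `S₂ = A₂ ∪ B₂`. [cite: LimayeSrinivasanTavenas2025, Claim 7] -/
theorem relRankPair_mul [DecidableEq ι] {A₁ A₂ B₁ B₂ : Finset ι} (hA : Disjoint A₁ A₂)
    (hB : Disjoint B₁ B₂) (hS : Disjoint (A₁ ∪ B₁) (A₂ ∪ B₂))
    {f g : MvPolynomial (Σ i, X i) K} (hf : IsSetMultilinear Sigma.fst (A₁ ∪ B₁) f)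
    (hg : IsSetMultilinear Sigma.fst (A₂ ∪ B₂) g) :
    relRankPair K (A₁ ∪ A₂) (B₁ ∪ B₂) (f * g) = relRankPair K A₁ B₁ f * relRankPair K A₂ B₂ g := by
  unfold relRankPair
  rw [pdRank_mul hA hB hS hf hg, Nat.cast_mul, Finset.prod_union hA, Finset.prod_union hB,
    div_mul_div_comm, ← Real.sqrt_mul (mul_nonneg (Finset.prod_nonneg fun _ _ => by positivity)
      (Finset.prod_nonneg fun _ _ => by positivity))]
  congr 2
  ring

/-- Over no blocks, the coefficient matrix of the constant `1` is the `1 × 1` matrix `(1)`, of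
rank `1`. [folklore] -/
theorem pdRank_one_of_eq_empty {A B : Finset ι} (hA : A = ∅) (hB : B = ∅) :
    pdRank K A B (1 : MvPolynomial (Σ i, X i) K) = 1 := by
  subst hA; subst hB
  unfold pdRank
  have hrow : ∀ r : Assignment X (∅ : Finset ι), ∀ c : Assignment X (∅ : Finset ι),
      coeffMat K ∅ ∅ (1 : MvPolynomial (Σ i, X i) K) r c = 1 := by
    intro r c
    simp [coeffMat, assignMonomial]
  let r₀ : Assignment X (∅ : Finset ι) := fun i => (Finset.notMem_empty _ i.2).elim
  have huniq : ∀ r : Assignment X (∅ : Finset ι), r = r₀ := fun r =>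
    funext fun i => (Finset.notMem_empty _ i.2).elim
  have htop : span K (Set.range (coeffMat K ∅ ∅ (1 : MvPolynomial (Σ i, X i) K))) = ⊤ := by
    rw [eq_top_iff]
    intro x _
    have hx : x = x r₀ • coeffMat K ∅ ∅ (1 : MvPolynomial (Σ i, X i) K) r₀ := by
      funext c
      rw [Pi.smul_apply, hrow, smul_eq_mul, mul_one, huniq c]
    rw [hx]
    exact Submodule.smul_mem _ _ (subset_span ⟨_, rfl⟩)
  rw [htop, finrank_top, Module.finrank_fintype_fun_eq_card, Fintype.card_eq_one_iff]
  exact ⟨r₀, huniq⟩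

/-- `relrk` of the constant `1` over no blocks is `1`. [folklore] -/
theorem relRankPair_one_of_eq_empty {A B : Finset ι} (hA : A = ∅) (hB : B = ∅) :
    relRankPair K A B (1 : MvPolynomial (Σ i, X i) K) = 1 := by
  unfold relRankPair
  rw [pdRank_one_of_eq_empty hA hB, hA, hB]
  simp

/-! ### The `pos`/`S` wrapper -/

section Wrapper

variable (pos : ι → Bool)

/-- Positive and negative parts of a block set are disjoint. [folklore] -/
theorem disjoint_filter_pos_neg (S : Finset ι) :
    Disjoint (S.filter fun i => pos i) (S.filter fun i => !pos i) := by
  rw [Finset.disjoint_filter]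
  intro i _ h
  simpa using h

/-- A block set is the union of its positive and negative parts. [folklore] -/
theorem filter_pos_union_filter_neg [DecidableEq ι] (S : Finset ι) :
    (S.filter fun i => pos i) ∪ (S.filter fun i => !pos i) = S := by
  ext i
  simp only [Finset.mem_union, Finset.mem_filter]
  cases pos i <;> simp

/-- `relrk ≥ 0`. [cite: LimayeSrinivasanTavenas2025, §2.1] -/
theorem relRank_nonneg (S : Finset ι) (f : MvPolynomial (Σ i, X i) K) : 0 ≤ relRank K pos S f :=
  relRankPair_nonneg _ _ _

/-- `relrk ≤ 1`. [cite: LimayeSrinivasanTavenas2025, §2.1] -/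
theorem relRank_le_one [DecidableEq ι] [∀ i, Nonempty (X i)] (S : Finset ι)
    (f : MvPolynomial (Σ i, X i) K) : relRank K pos S f ≤ 1 :=
  relRankPair_le_one _ _ _

/-- Sub-additivity (LST 2025, Claim 7(2)). [cite: LimayeSrinivasanTavenas2025, Claim 7] -/
theorem relRank_add_le (S : Finset ι) (f g : MvPolynomial (Σ i, X i) K) :
    relRank K pos S (f + g) ≤ relRank K pos S f + relRank K pos S g :=
  relRankPair_add_le _ _ _ _

/-- Scalars are free. [cite: LimayeSrinivasanTavenas2025, Claim 7] -/
theorem relRank_smul_le (S : Finset ι) (a : K) (f : MvPolynomial (Σ i, X i) K) :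
    relRank K pos S (a • f) ≤ relRank K pos S f :=
  relRankPair_smul_le _ _ _ _

/-- `relrk 0 = 0`. [folklore] -/
@[simp]
theorem relRank_zero (S : Finset ι) : relRank K pos S (0 : MvPolynomial (Σ i, X i) K) = 0 :=
  relRankPair_zero _ _

/-- Linear combinations (LST 2025, Claim 7(2)). [cite: LimayeSrinivasanTavenas2025, Claim 7] -/
theorem relRank_sum_smul_le {κ : Type*} (s : Finset κ) (S : Finset ι) (a : κ → K)
    (f : κ → MvPolynomial (Σ i, X i) K) :
    relRank K pos S (∑ j ∈ s, a j • f j) ≤ ∑ j ∈ s, relRank K pos S (f j) :=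
  relRankPair_sum_smul_le _ _ _ _ _

/-- **Span bound**: if `f` lies in the span of finitely many polynomials `g j`, then
`relrk(f) ≤ ∑ⱼ relrk(g j)` (LST 2025, Claim 7(2) with free scalars).
[cite: LimayeSrinivasanTavenas2025, Claim 7] -/
theorem relRank_le_sum_of_mem_span {κ : Type*} [Fintype κ] (S : Finset ι)
    {f : MvPolynomial (Σ i, X i) K} {g : κ → MvPolynomial (Σ i, X i) K}
    (h : f ∈ span K (Set.range g)) : relRank K pos S f ≤ ∑ j, relRank K pos S (g j) := by
  obtain ⟨a, rfl⟩ := (Submodule.mem_span_range_iff_exists_fun K).1 h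
  exact relRank_sum_smul_le pos _ S a g

/-- `relrk_{w|S}` only sees the set-multilinear part over `S`.
[cite: LimayeSrinivasanTavenas2025, §2.1] -/
theorem relRank_smlProj [DecidableEq ι] (S : Finset ι) (f : MvPolynomial (Σ i, X i) K) :
    relRank K pos S (smlProj Sigma.fst S f) = relRank K pos S f := by
  unfold relRank
  have h := relRankPair_smlProj (K := K) (disjoint_filter_pos_neg pos S) f
  rwa [filter_pos_union_filter_neg] at h

/-- A polynomial set-multilinear over `T ≠ S` has `relrk_{w|S} = 0`.
[cite: LimayeSrinivasanTavenas2025, §2.1] -/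
theorem relRank_eq_zero_of_isSetMultilinear [DecidableEq ι] {S T : Finset ι}
    {f : MvPolynomial (Σ i, X i) K} (hf : IsSetMultilinear Sigma.fst T f) (hT : S ≠ T) :
    relRank K pos S f = 0 := by
  rw [← relRank_smlProj, hf.smlProj_of_ne _ hT, relRank_zero]

/-- **Multiplicativity** (LST 2025, Claim 7(3), binary case): for `f` set-multilinear over `S₁`
and `g` over the disjoint `S₂`, `relrk_{w|S₁∪S₂}(f g) = relrk_{w|S₁}(f) · relrk_{w|S₂}(g)`.
[cite: LimayeSrinivasanTavenas2025, Claim 7] -/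
theorem relRank_mul [DecidableEq ι] {S₁ S₂ : Finset ι} (h : Disjoint S₁ S₂)
    {f g : MvPolynomial (Σ i, X i) K} (hf : IsSetMultilinear Sigma.fst S₁ f)
    (hg : IsSetMultilinear Sigma.fst S₂ g) :
    relRank K pos (S₁ ∪ S₂) (f * g) = relRank K pos S₁ f * relRank K pos S₂ g := by
  unfold relRank
  rw [Finset.filter_union, Finset.filter_union]
  refine relRankPair_mul ?_ ?_ ?_ ?_ ?_
  · exact Finset.disjoint_filter_filter h
  · exact Finset.disjoint_filter_filter h
  · rwa [filter_pos_union_filter_neg, filter_pos_union_filter_neg]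
  · rwa [filter_pos_union_filter_neg]
  · rwa [filter_pos_union_filter_neg]

omit [∀ i, Fintype (X i)] in
/-- Products of set-multilinear polynomials over pairwise disjoint block sets are set-multilinear
over the union. [cite: LimayeSrinivasanTavenas2025, Claim 7] -/
theorem isSetMultilinear_finset_prod [DecidableEq ι] {κ : Type*} (s : Finset κ)
    (U : κ → Finset ι) (F : κ → MvPolynomial (Σ i, X i) K)
    (hdisj : (s : Set κ).PairwiseDisjoint U)
    (hF : ∀ j ∈ s, IsSetMultilinear Sigma.fst (U j) (F j)) :
    IsSetMultilinear (Sigma.fst : (Σ i, X i) → ι) (s.biUnion U) (∏ j ∈ s, F j) := by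
  classical
  induction s using Finset.induction_on with
  | empty => simpa using isSetMultilinear_C (R := K) (Sigma.fst : (Σ i, X i) → ι) 1
  | insert j s hj ih =>
    rw [Finset.prod_insert hj, Finset.biUnion_insert]
    have hs : (s : Set κ).PairwiseDisjoint U := hdisj.subset (by simp)
    refine IsSetMultilinear.mul _ (hF j (Finset.mem_insert_self j s))
      (ih hs fun j' hj' => hF j' (Finset.mem_insert_of_mem hj')) ?_
    rw [Finset.disjoint_biUnion_right]
    intro j' hj'
    exact hdisj (Finset.mem_insert_self j s) (Finset.mem_insert_of_mem hj')
      (fun h => hj (h ▸ hj'))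

/-- **Multiplicativity, general form** (LST 2025, Claim 7(3)):
`relrk_w(f₁ ⋯ f_t) = ∏ᵢ relrk_{w|Sᵢ}(fᵢ)` for `fᵢ` set-multilinear over pairwise disjoint `Sᵢ`.
[cite: LimayeSrinivasanTavenas2025, Claim 7] -/
theorem relRank_finset_prod [DecidableEq ι] {κ : Type*} (s : Finset κ) (U : κ → Finset ι)
    (F : κ → MvPolynomial (Σ i, X i) K) (hdisj : (s : Set κ).PairwiseDisjoint U)
    (hF : ∀ j ∈ s, IsSetMultilinear Sigma.fst (U j) (F j)) :
    relRank K pos (s.biUnion U) (∏ j ∈ s, F j) = ∏ j ∈ s, relRank K pos (U j) (F j) := by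
  classical
  induction s using Finset.induction_on with
  | empty =>
    simp only [Finset.biUnion_empty, Finset.prod_empty]
    exact relRankPair_one_of_eq_empty (Finset.filter_empty _) (Finset.filter_empty _)
  | insert j s hj ih =>
    have hs : (s : Set κ).PairwiseDisjoint U := hdisj.subset (by simp)
    rw [Finset.prod_insert hj, Finset.biUnion_insert, Finset.prod_insert hj,
      relRank_mul pos ?_ (hF j (Finset.mem_insert_self j s))
        (isSetMultilinear_finset_prod s U F hs fun j' hj' => hF j' (Finset.mem_insert_of_mem hj')),
      ih hs fun j' hj' => hF j' (Finset.mem_insert_of_mem hj')]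
    rw [Finset.disjoint_biUnion_right]
    intro j' hj'
    exact hdisj (Finset.mem_insert_self j s) (Finset.mem_insert_of_mem hj')
      (fun h => hj (h ▸ hj'))

/-- **Imbalance for `relRank`** (LST 2025, Claim 7(1)): `relrk_{w|S}(f) ≤ √(#rows/#cols)` where
`#rows = ∏_{i ∈ S, pos i} |X i|`, `#cols = ∏_{i ∈ S, ¬ pos i} |X i|`.
[cite: LimayeSrinivasanTavenas2025, Claim 7] -/
theorem relRank_le_sqrt_div [DecidableEq ι] [∀ i, Nonempty (X i)] (S : Finset ι)
    (f : MvPolynomial (Σ i, X i) K) :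
    relRank K pos S f ≤ Real.sqrt ((∏ i ∈ S.filter fun i => pos i, (Fintype.card (X i) : ℝ)) /
      ∏ i ∈ S.filter fun i => !pos i, (Fintype.card (X i) : ℝ)) :=
  relRankPair_le_sqrt_div _ _ _

/-- **Imbalance for `relRank`, column form** (LST 2025, Claim 7(1)):
`relrk_{w|S}(f) ≤ √(#cols/#rows)`. [cite: LimayeSrinivasanTavenas2025, Claim 7] -/
theorem relRank_le_sqrt_div' [DecidableEq ι] [∀ i, Nonempty (X i)] (S : Finset ι)
    (f : MvPolynomial (Σ i, X i) K) :
    relRank K pos S f ≤ Real.sqrt ((∏ i ∈ S.filter fun i => !pos i, (Fintype.card (X i) : ℝ)) /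
      ∏ i ∈ S.filter fun i => pos i, (Fintype.card (X i) : ℝ)) :=
  relRankPair_le_sqrt_div' _ _ _

end Wrapper

end Rank

end Literature.Computability.AlgebraicComplexity
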